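import Mathlib
import HarnessLib
import Summits.QuantumFields.YangMills.Theses.FradkinShenkerFlow
import Summits.QuantumFields.YangMills.Theses.EquipartitionCriticality
import Summits.QuantumFields.YangMills.Theses.DirichletWindow
import Summits.QuantumFields.YangMills.Theorems.HypercubicLimit.Negative.AllTimesGapFalse

/-!
# Crux triage r1-3 (stmt-QuantumFields-9443 `ClusteringToYangMills`) — sharpening of the dock line

The three dock cards (`spectral-requantisation-dock`, `antipodal-docking`, `dock-continuum-leg`) prove
`adapter → XiDiverges → CriticalityOfXiDiverges → CriticalContinuumLimit → ClusteringToYangMills` and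
describe the adapter (`TorusGapUniformisation` = `TorusConstantsUpgrade` = `UniformiseConstants`: H ⇒ the
β-UNIFORM `LatticeGapLargeBeta` shape) as needing a β-free thermal bound (T½)/(GV), "separable growth",
resp. `ThermalRatioBound` at the sharp rate.

CHECKED HERE: for docking on `CriticalContinuumLimit` (stmt-8762) NO β-uniformity and NO rate condition is
needed.  It suffices that, at EACH β separately, the clustering constants are STRUCTURED — a β-free
prefactor `w A B` times `exp (Γ_β · (κ A + κ B))` for a β-free size functional `κ` and ANY `Γ_β`, `μ_β > 0`
(`StructuredH`).  β-uniform constants are then bought by RATE SACRIFICE `m(β) := μ_β / max 1 Γ_β`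
(`rate_sacrifice`, elementary), which is legal because 8762's criticality hypothesis quantifies over ALL
admissible rates and is fed by `CriticalityOfXiDiverges` independently of H (`dock_structured`).
On route FradkinShenkerFlow, `PoincareToClustering`'s Martinelli-type proof (gap + β-independent finite
speed of the rate-1 heat bath) yields exactly such structured constants `K(β)(|supp A|+|supp B|)‖A‖‖B‖`
(card antipodal-docking, "Why it bites" (3)); so re-typing 9444's conclusion / 9443's hypothesis in
structured form makes 9443 ⇐ 8762 ∧ XiDiverges ∧ 12318 pure bookkeeping — Γ ≡ 1 is NOT required.
-/

noncomputable section

namespace Summit.QuantumFields.YangMills.Cruxes.ClusteringToYangMills.Triage3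

open Literature.MathematicalPhysics.QuantumFieldTheory
open Summit.QuantumFields.YangMills.Theorems.HypercubicLimit.Negative
open Summit.QuantumFields.YangMills

/-- **Rate sacrifice** (elementary): an a-priori bound `|c| ≤ a` and a clustering bound with a
multiplicative excess `exp (Γ K)` combine into a clustering bound with the `Γ`-FREE constant
`a · w · exp K` at the slower rate `μ / max 1 Γ`. [folklore] -/
theorem rate_sacrifice {a w K Γ μ x c : ℝ} (ha : 1 ≤ a) (hw : 1 ≤ w) (hK : 0 ≤ K)
    (h1 : |c| ≤ a) (h2 : |c| ≤ w * Real.exp (Γ * K) * Real.exp (-(μ * x))) :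
    |c| ≤ a * w * Real.exp K * Real.exp (-(μ / max 1 Γ * x)) := by
  set L := max 1 Γ with hL
  have hL1 : 1 ≤ L := le_max_left _ _
  have hLΓ : Γ ≤ L := le_max_right _ _
  have hL0 : 0 < L := lt_of_lt_of_le one_pos hL1
  have ha0 : 0 ≤ a := le_trans zero_le_one ha
  have haw : 1 ≤ a * w := by nlinarith
  by_cases h : μ * x ≤ L * K
  · -- small separations: the a-priori bound, `exp K · exp (-(μ/L) x) ≥ 1`
    have hle : μ / L * x ≤ K := by
      rw [div_mul_eq_mul_div, div_le_iff₀ hL0]; linarith [mul_comm L K]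
    have hone : 1 ≤ Real.exp K * Real.exp (-(μ / L * x)) := by
      rw [← Real.exp_add]; exact Real.one_le_exp (by linarith)
    calc |c| ≤ a := h1
      _ ≤ a * w := by nlinarith
      _ = a * w * 1 := (mul_one _).symm
      _ ≤ a * w * (Real.exp K * Real.exp (-(μ / L * x))) := by
          exact mul_le_mul_of_nonneg_left hone (by linarith)
      _ = a * w * Real.exp K * Real.exp (-(μ / L * x)) := by ring
  · push Not at h
    have h3 : K < μ * x / L := by rw [lt_div_iff₀ hL0]; linarith
    have h4 : K * (L - 1) ≤ μ * x / L * (L - 1) :=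
      mul_le_mul_of_nonneg_right h3.le (by linarith)
    have h5 : K * Γ ≤ K * L := mul_le_mul_of_nonneg_left hLΓ hK
    have h7 : μ * x / L * (L - 1) = μ * x - μ * x / L := by
      field_simp
    have h6 : μ / L * x = μ * x / L := by ring
    have key : Γ * K + -(μ * x) ≤ K + -(μ / L * x) := by
      rw [h6]; rw [h7] at h4; nlinarith [h4, h5]
    calc |c| ≤ w * Real.exp (Γ * K) * Real.exp (-(μ * x)) := h2
      _ = w * Real.exp (Γ * K + -(μ * x)) := by rw [Real.exp_add]; ring
      _ ≤ w * Real.exp (K + -(μ / L * x)) :=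
          mul_le_mul_of_nonneg_left (Real.exp_le_exp.2 key) (by linarith)
      _ = 1 * w * (Real.exp K * Real.exp (-(μ / L * x))) := by rw [Real.exp_add]; ring
      _ ≤ a * w * (Real.exp K * Real.exp (-(μ / L * x))) := by
          apply mul_le_mul_of_nonneg_right _ (by positivity)
          exact mul_le_mul_of_nonneg_right ha (by linarith)
      _ = a * w * Real.exp K * Real.exp (-(μ / L * x)) := by ring

variable {G : Type} [Group G] [TopologicalSpace G] [IsTopologicalGroup G] [CompactSpace G]
  [MeasurableSpace G] [BorelSpace G]

variable (G) in
/-- H of the crux for one `(G, r)` (verbatim antecedent of `ClusteringToYangMills`, = Sketch-ideator1's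
`TorusClusteringH`). [folklore] -/
def TorusClusteringH (r : LatticeRep G) : Prop :=
  ∃ β₀ : ℝ, ∀ β : ℝ, β₀ ≤ β → (∃ m : ℝ, 0 < m ∧ ∀ A B : YMSpecies G, ∃ C : ℝ, ∀ S n : ℕ, n ≤ S →
    |latticeConnectedCorr r.ρ β (2 * S + 1) A.F B.F n| ≤ C * Real.exp (-(m * n)))

variable (G) in
/-- The β-uniform large-torus form (= body of `EquipartitionCriticality.LatticeGapLargeBeta`, hypothesis 1
of `CriticalContinuumLimit`; = Sketch-ideator1's `UniformTorusGap`). [folklore] -/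
def UniformTorusGap (r : LatticeRep G) : Prop :=
  ∃ (β₁ : ℝ) (m : ℝ → ℝ) (S₀ : ℝ → ℕ), (∀ β : ℝ, β₁ ≤ β → 0 < m β) ∧
    ∀ A B : YMSpecies G, ∃ C : ℝ, ∀ β : ℝ, β₁ ≤ β → ∀ S n : ℕ, S₀ β ≤ S → n ≤ S →
      |latticeConnectedCorr r.ρ β (2 * S + 1) A.F B.F n| ≤ C * Real.exp (-(m β * n))

variable (G) in
/-- **Structured H** (per β, NOTHING uniform in β): a β-free size functional `κ ≥ 0` and a β-free
prefactor `w ≥ 1` such that at each `β ≥ β₀` there are SOME rate `μ_β > 0` and SOME `Γ_β` with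
`|corr_β(A,B;n)| ≤ w A B · exp (Γ_β (κ A + κ B)) · exp (-μ_β n)` on all tori, `n ≤ S`.  (The shape a
Martinelli-type "gap + finite speed" proof of `PoincareToClustering` delivers, with
`w A B = ‖A‖‖B‖(|supp A| + |supp B|)`, `κ = 0`; and the shape "infinite-volume OS self-normalisation
`e^{m_∞ · width}` + a per-β torus finite-size bound" delivers, with `κ` = time-width of the support.)
[folklore] -/
def StructuredH (r : LatticeRep G) : Prop :=
  ∃ κ : YMSpecies G → ℝ, (∀ A, 0 ≤ κ A) ∧ ∃ w : YMSpecies G → YMSpecies G → ℝ, (∀ A B, 1 ≤ w A B) ∧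
    ∃ β₀ : ℝ, ∀ β : ℝ, β₀ ≤ β → ∃ μ Γ : ℝ, 0 < μ ∧
      ∀ A B : YMSpecies G, ∀ S n : ℕ, n ≤ S →
        |latticeConnectedCorr r.ρ β (2 * S + 1) A.F B.F n| ≤
          w A B * Real.exp (Γ * (κ A + κ B)) * Real.exp (-(μ * n))

/-- **Structured H ⇒ the β-uniform `LatticeGapLargeBeta` shape**, by rate sacrifice alone
(`m(β) := μ_β / max 1 Γ_β`, `S₀ ≡ 0`, `C(A,B) := max 1 (2 C_A C_B) · w A B · exp (κ A + κ B)`).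
No thermal bound uniform in β, no spectral rate, no torus threshold is needed for THIS step. [folklore] -/
theorem uniformTorusGap_of_structuredH (r : LatticeRep G) (h : StructuredH G r) :
    UniformTorusGap G r := by
  obtain ⟨κ, hκ, w, hw, β₀, hβ⟩ := h
  choose μ Γ hμ hb using hβ
  refine ⟨β₀, fun β => if h : β₀ ≤ β then μ β h / max 1 (Γ β h) else 1, fun _ => 0, ?_, ?_⟩
  · intro β hβ0
    simp only [hβ0, ↓reduceDIte]
    exact div_pos (hμ β hβ0) (lt_of_lt_of_le one_pos (le_max_left _ _))
  · intro A B
    obtain ⟨CA, hCA⟩ := A.bounded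
    obtain ⟨CB, hCB⟩ := B.bounded
    refine ⟨max 1 (2 * (CA * CB)) * w A B * Real.exp (κ A + κ B), fun β hβ0 S n _ hn => ?_⟩
    have h1 : |latticeConnectedCorr r.ρ β (2 * S + 1) A.F B.F n| ≤ max 1 (2 * (CA * CB)) :=
      (abs_latticeConnectedCorr_le r β (2 * S + 1) hCA hCB n).trans (le_max_right _ _)
    have h2 := hb β hβ0 A B S n hn
    have := rate_sacrifice (le_max_left _ _) (hw A B) (add_nonneg (hκ A) (hκ B)) h1 h2
    simpa only [hβ0, ↓reduceDIte] using this

/-- The adapter of the dock cards, weakened to "structure the constants per β". [folklore] -/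
def StructuringAdapter : Prop :=
  ∀ (G : Type) [Group G] [TopologicalSpace G] [IsTopologicalGroup G] [CompactSpace G]
    [MeasurableSpace G] [BorelSpace G], IsCompactSimpleLieGroup G → ∀ r : LatticeRep G,
    TorusClusteringH G r → StructuredH G r

omit [Group G] [TopologicalSpace G] [IsTopologicalGroup G] [CompactSpace G] [MeasurableSpace G]
  [BorelSpace G] in
/-- **Dock with the weakened adapter** (pure logic + `uniformTorusGap_of_structuredH`): the crux follows
from per-β STRUCTURING of H's constants and the three existing sibling items. [folklore] -/
theorem dock_structured (hU : StructuringAdapter)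
    (hXi : Theses.DirichletWindow.XiDiverges)
    (hCrit : Theses.DirichletWindow.CriticalityOfXiDiverges)
    (hCCL : Theses.EquipartitionCriticality.CriticalContinuumLimit) :
    Theses.FradkinShenkerFlow.ClusteringToYangMills := by
  intro hH G _ _ _ _ hG
  letI : MeasurableSpace G := borel G
  haveI : BorelSpace G := ⟨rfl⟩
  have h1 : ∀ r : LatticeRep G, UniformTorusGap G r :=
    fun r => uniformTorusGap_of_structuredH r (hU G hG r (hH G hG r))
  exact hCCL G hG h1 (hCrit hXi G hG)

end Summit.QuantumFields.YangMills.Cruxes.ClusteringToYangMills.Triage3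

end
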